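import Summits.Ventures.LatticeQCDFlow.Scaling.TaggedCostSideDeep

/-!
HONEST FRAMING: exact (Metropolis-corrected) sampling algorithms for lattice gauge theory; figures
of merit are autocorrelation/cost numbers at stated couplings and volumes; no continuum-physics
claim.

# TaggedStartContentKernelRecursion — THE EXACT ONE-STEP RECURSION OF THE START-CONTENT DEFICIT AT KERNEL LEVEL, FOR EVERY ADJACENT PAIR (MASS-CONSERVATION FORM):
# `e_{n+1} = (P_Y(z,z) − N_C(z)/K)·e_n − γ·x_n(z) + (N_C(z)/K)·Σ_{t≠z}(x_n(t) − y_n(t))(1 − acc(t,z))` WHEN `W_z ≤ W_b` (lean-2 GEN-42, ours)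

Venture-side (OURS).  Cell `lqcd-flow` (pub-lqcd), unit `pub-lqcd-lean-2-g42`, 2026-08-30.  Chapter AB (route (β), the cost side continued), file 18 — a kernel-level identity, no
enumeration, no configuration hypothesis.  GEN-41 file 1's exact recursion lives on the sorted class chain; MEMO-gen41 §4 (v) asked for its kernel-level form on global edges.  For
W26's tagged chains `P_X` (tag `a`), `P_Y` (tag `b`) over a common composition and the `n`-attempt laws `x_n, y_n` from an ordinary hub `z` with `W_z ≤ W_b ≤ W_a`: the two
kernels agree at every entry INTO `z` from an ordinary content, both tags enter `z` with probability `N_C(z)/K` (`acc(a,z) = acc(b,z) = 1`), and mass conservation turns the ★-term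
into the ordinary gaps; hence, with `e_n = y_n(z) − x_n(z)`, `γ = P_X(z,z) − P_Y(z,z)`:

* `tagged_laws_mass` (`Σ_t x_n(t) = 1`), **`tagged_deficit_succ_eq`**:
  `e_{n+1} = (P_Y(z,z) − N_C(z)/K)·e_n − γ·x_n(z) + (N_C(z)/K)·Σ_{t≠z}(x_n(t) − y_n(t))·(1 − 𝟙{N_C(t)≠0}acc(t,z))`.

Reading: the deficit is fed ONLY by `X`'s surplus at contents strictly LESS persistent than `z` (`acc(t,z) = 1` for `W_t ≥ W_z`), damped by `β^Y_z = P_Y(z,z) − N_C(z)/K` and drained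
by `γx_n(z)`; on global edges the intermediate contents (above `W_b ≥ W_z`) do not enter.  TOY `numerics42/rec_check.py` (exact rationals): 0 failures in 888 instances before typing.
Literature grade (cell rule): OWN, bookkeeping; nothing cited; no new bib keys.
-/

open Finset

namespace Summit.Ventures.LatticeQCDFlow.Scaling

section KernelRecursion
variable {S : Type*} [Fintype S] [DecidableEq S]
variable {W : S → ℝ} {acc : S → S → ℝ} {K : ℕ} {NC : S → ℕ} {a b : S} {PX PY : Option S → Option S → ℝ}

omit [DecidableEq S] in
/-- **The `n`-attempt laws are probability vectors:** `Σ_t x_n(t) = 1` (unit row sums). [ours] -/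
theorem tagged_laws_mass [DecidableEq S] (hP1 : ∀ t, ∑ t', PX t t' = 1) {z : S} {x : ℕ → Option S → ℝ}
    (hx0 : ∀ v, x 0 v = if v = some z then 1 else 0) (hxs : ∀ n v, x (n + 1) v = ∑ h, x n h * PX h v) (n : ℕ) :
    ∑ t, x n t = 1 := by
  induction n with
  | zero => simp_rw [hx0]; rw [sum_ite_eq']; simp
  | succ n ih =>
      simp_rw [hxs]
      rw [sum_comm]
      simp_rw [← mul_sum, hP1, mul_one]
      exact ih

/-- **THE EXACT ONE-STEP RECURSION OF THE START-CONTENT DEFICIT, KERNEL LEVEL, EVERY ADJACENT PAIR WITH `W_z ≤ W_b ≤ W_a`** (see the module docstring). [ours] -/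
theorem tagged_deficit_succ_eq (hW : ∀ v, 0 < W v) (hacc : ∀ h v, acc h v = min 1 (W h / W v)) (hab : W b ≤ W a)
    (hPXoff : ∀ h v, h ≠ v → PX (some h) (some v) = if NC h = 0 then 0 else (NC v : ℝ) / K * acc h v)
    (hPXdiag : ∀ h, PX (some h) (some h) = 1 - (∑ v ∈ univ.erase h, PX (some h) (some v) + PX (some h) none))
    (hPXout : ∀ v, PX none (some v) = (NC v : ℝ) / K * acc a v) (hPXstay : PX none none = 1 - ∑ v, PX none (some v))
    (hPYoff : ∀ h v, h ≠ v → PY (some h) (some v) = if NC h = 0 then 0 else (NC v : ℝ) / K * acc h v)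
    (hPYdiag : ∀ h, PY (some h) (some h) = 1 - (∑ v ∈ univ.erase h, PY (some h) (some v) + PY (some h) none))
    (hPYout : ∀ v, PY none (some v) = (NC v : ℝ) / K * acc b v) (hPYstay : PY none none = 1 - ∑ v, PY none (some v))
    {z : S} (hzb : W z ≤ W b) {x y : ℕ → Option S → ℝ}
    (hx0 : ∀ v, x 0 v = if v = some z then 1 else 0) (hxs : ∀ n v, x (n + 1) v = ∑ h, x n h * PX h v)
    (hy0 : ∀ v, y 0 v = if v = some z then 1 else 0) (hys : ∀ n v, y (n + 1) v = ∑ h, y n h * PY h v) (n : ℕ) :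
    y (n + 1) (some z) - x (n + 1) (some z)
      = (PY (some z) (some z) - (NC z : ℝ) / K) * (y n (some z) - x n (some z))
        - (PX (some z) (some z) - PY (some z) (some z)) * x n (some z)
        + (NC z : ℝ) / K * ∑ t ∈ univ.erase z, (x n (some t) - y n (some t)) * (1 - (if NC t = 0 then 0 else acc t z)) := by
  -- unit row sums and mass conservation
  have hP1X := tagged_rowsum (P := PX) hPXdiag hPXstay
  have hP1Y := tagged_rowsum (P := PY) hPYdiag hPYstay
  have hmx := tagged_laws_mass hP1X hx0 hxs n
  have hmy := tagged_laws_mass hP1Y hy0 hys n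
  rw [tagged_sum_option, ← add_sum_erase univ (fun v => x n (some v)) (mem_univ z)] at hmx
  rw [tagged_sum_option, ← add_sum_erase univ (fun v => y n (some v)) (mem_univ z)] at hmy
  -- both tags enter `z` with probability `N_C(z)/K`
  have hacc_az : acc a z = 1 := by rw [hacc]; exact min_eq_left ((one_le_div (hW z)).mpr (hzb.trans hab))
  have hacc_bz : acc b z = 1 := by rw [hacc]; exact min_eq_left ((one_le_div (hW z)).mpr hzb)
  have hinX : PX none (some z) = (NC z : ℝ) / K := by rw [hPXout, hacc_az, mul_one]
  have hinY : PY none (some z) = (NC z : ℝ) / K := by rw [hPYout, hacc_bz, mul_one]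
  -- ordinary entries into `z` agree
  have hagree : ∀ t ∈ univ.erase z, PY (some t) (some z) = PX (some t) (some z) := fun t ht => by
    rw [hPXoff t z (ne_of_mem_erase ht), hPYoff t z (ne_of_mem_erase ht)]
  have hentry : ∀ t ∈ univ.erase z, PX (some t) (some z) = (NC z : ℝ) / K * (if NC t = 0 then 0 else acc t z) := fun t ht => by
    rw [hPXoff t z (ne_of_mem_erase ht)]
    split_ifs <;> ring
  -- expand the two laws at `z`
  rw [hxs, hys, tagged_sum_option, tagged_sum_option,
    ← add_sum_erase univ (fun h => x n (some h) * PX (some h) (some z)) (mem_univ z),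
    ← add_sum_erase univ (fun h => y n (some h) * PY (some h) (some z)) (mem_univ z), hinX, hinY]
  have hsumY : ∑ h ∈ univ.erase z, y n (some h) * PY (some h) (some z) = ∑ h ∈ univ.erase z, y n (some h) * PX (some h) (some z) :=
    sum_congr rfl fun h hh => by rw [hagree h hh]
  rw [hsumY]
  have hsumE : ∑ h ∈ univ.erase z, x n (some h) * PX (some h) (some z) - ∑ h ∈ univ.erase z, y n (some h) * PX (some h) (some z)
      = (NC z : ℝ) / K * ∑ t ∈ univ.erase z, (x n (some t) - y n (some t)) * (if NC t = 0 then 0 else acc t z) := by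
    rw [← sum_sub_distrib, mul_sum]
    exact sum_congr rfl fun t ht => by rw [hentry t ht]; ring
  -- the ★-masses by conservation: `y_n(★) − x_n(★) = Σ_{t≠z}(x_n(t) − y_n(t)) + (x_n(z) − y_n(z))`
  have hstar : y n none - x n none = (∑ t ∈ univ.erase z, (x n (some t) - y n (some t))) + (x n (some z) - y n (some z)) := by
    rw [sum_sub_distrib]; linarith
  -- assemble
  have hsplit : (NC z : ℝ) / K * ∑ t ∈ univ.erase z, (x n (some t) - y n (some t)) * (1 - (if NC t = 0 then 0 else acc t z))
      = (NC z : ℝ) / K * ∑ t ∈ univ.erase z, (x n (some t) - y n (some t))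
        - (NC z : ℝ) / K * ∑ t ∈ univ.erase z, (x n (some t) - y n (some t)) * (if NC t = 0 then 0 else acc t z) := by
    rw [← mul_sub, ← sum_sub_distrib]
    congr 1
    exact sum_congr rfl fun t _ => by ring
  rw [hsplit]
  linear_combination ((NC z : ℝ) / K) * hstar - hsumE

end KernelRecursion

end Summit.Ventures.LatticeQCDFlow.Scaling
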